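import Summits.HodgeConjecture.HodgeConjecture.Theorems.Q8SymplecticPowersEndomorphismAlgebra
import HarnessLib

/-!
# Route `Q8SymplecticPowers`, programme K2Q ∕ F-Q — brick F2a: **matching coefficient tensors WITH FREE SLOTS**
# (covariance under a change of letters) and **descent of function spans from `ℂ` to `ℚ`**

Support file for crux K2Q `PowersHodgeOfQuaternionCommutators` (stmt-HodgeConjecture-24191; `--supports … --as helper`;
nothing here closes an item). Prover seat `hodge-nonav-20241-p1` (g21). Pure linear algebra.

The matching tensors of brick A-Q (`Q8SymplecticPowersMatchingClassesAlgebraic`, p706844) have coefficient functions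
`w ↦ (∏_c Θ_{δ c}(w p_c, w q_c)) · ∏_a ζ_a(w s_a)` for a matching `ε : P ≃ (Fin 2 × J) ⊕ L` of the positions (pairs `(p_c, q_c)`,
free slots `s_a` carrying coordinate vectors `ζ_a`). This file supplies the two bookkeeping facts the all-powers stub
`stub_higherPowersQ` needs about them:

* **`sum_prod_mul_matchingFree`** — covariance under a rectangular matrix `M : A₂ × A₁` acting on all letters:
  `Σ_w (∏_p M (w' p) (w p)) · mf(Θ, ζ)(w) = mf(M Θ Mᵀ, M ζ)(w')` (twin with free slots of the tree's
  `sum_prod_mul_taggedContraction`, Goodman–Wallach §5.3.2); this is the change of basis of matching tensors and the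
  reassembly of block slices;
* **`mem_span_of_algebraMap_mem_span`** — a rational coefficient function whose complexification lies in the `ℂ`-span of the
  complexifications of a set of rational functions lies in their `ℚ`-span (a `ℚ`-linear retraction `ℂ → ℚ` of `1`,
  `Q8SymplecticPowersEndomorphismAlgebra.exists_ratLinear_retraction`, applied pointwise).

HONEST FRAMING: linear algebra only (axioms standard); item 24191 OPEN; nothing here says HC ∕ HC_CM ∕ HC_AV is proved.

## References

* R. Goodman, N. Wallach, *Symmetry, Representations, and Invariants*, GTM 255, §5.3.2 (complete contractions),
  §4.2.2 Prop. 4.2.5. [cite: GoodmanWallachGTM255]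
-/

set_option linter.dupNamespace false

noncomputable section

open scoped BigOperators Matrix

namespace Summit.HodgeConjecture.HodgeConjecture.Theorems.Q8SymplecticPowersMatchingFreeSlots

open Summit.HodgeConjecture.HodgeConjecture.Theorems.Q8SymplecticPowersEndomorphismAlgebra (exists_ratLinear_retraction)

universe u

/-! ### §1 Matching coefficient tensors with free slots: covariance -/

section Covariance

variable {K : Type u} [Field K] {A₁ A₂ ι : Type*} {P J L : Type*} [Fintype J] [Fintype L]

/-- The matching coefficient tensor with free slots: pairs `c : J` contracted with `Θ (δ c)`, free slots `a : L` carrying the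
coordinate vectors `ζ a`. Local notation only. [cite: GoodmanWallachGTM255, §5.3.2] -/
local notation3 (prettyPrint := false) "mf[" Θ ", " δ ", " ζ ", " e "]" =>
  (fun w => (∏ c, Θ (δ c) (w (Equiv.symm e (Sum.inl ((0 : Fin 2), c)))) (w (Equiv.symm e (Sum.inl ((1 : Fin 2), c))))) *
    ∏ a, ζ a (w (Equiv.symm e (Sum.inr a))))

omit [Fintype J] [Fintype L] in
/-- Words on `P` in the alphabet `A₁`, read through a matching `ε`, are (pair letters, free letters).
[cite: GoodmanWallachGTM255, §5.3.2] -/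
theorem exists_wordEquiv [DecidableEq J] (ε : P ≃ (Fin 2 × J) ⊕ L) :
    ∃ E : (P → A₁) ≃ (J → A₁ × A₁) × (L → A₁),
      (∀ w j, (E w).1 j = (w (ε.symm (Sum.inl (0, j))), w (ε.symm (Sum.inl (1, j))))) ∧
      (∀ w a, (E w).2 a = w (ε.symm (Sum.inr a))) := by
  classical
  let toF : (P → A₁) → (J → A₁ × A₁) × (L → A₁) := fun w =>
    (fun j => (w (ε.symm (Sum.inl (0, j))), w (ε.symm (Sum.inl (1, j)))), fun a => w (ε.symm (Sum.inr a)))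
  let invF : (J → A₁ × A₁) × (L → A₁) → (P → A₁) := fun vs p =>
    Sum.elim (fun ij : Fin 2 × J => if ij.1 = 0 then (vs.1 ij.2).1 else (vs.1 ij.2).2) (fun a => vs.2 a) (ε p)
  have hleft : Function.LeftInverse invF toF := by
    intro w
    funext p
    obtain ⟨q, hq⟩ : ∃ q, ε p = q := ⟨_, rfl⟩
    have hp : p = ε.symm q := by rw [← hq, Equiv.symm_apply_apply]
    subst hp
    simp only [invF, toF, Equiv.apply_symm_apply]
    rcases q with ⟨i, j⟩ | a
    · fin_cases i <;> simp
    · simp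
  have hright : Function.RightInverse invF toF := by
    rintro ⟨v, s⟩
    simp only [invF, toF, Equiv.apply_symm_apply, Sum.elim_inl, Sum.elim_inr, if_true, Fin.one_eq_zero_iff]
    rfl
  exact ⟨⟨toF, invF, hleft, hright⟩, fun w j => rfl, fun w a => rfl⟩

/-- **Covariance of matching coefficient tensors with free slots**: pushing `mf(Θ, ζ)` through the Kronecker power of a
rectangular matrix `M` replaces each pair matrix `Θ_i` by `M Θ_i Mᵀ` and each free vector `ζ_a` by `M ζ_a`.
[cite: GoodmanWallachGTM255, §5.3.2] -/
theorem sum_prod_mul_matchingFree [Fintype A₁] [Fintype P] [DecidableEq P] [DecidableEq J] [DecidableEq L]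
    (M : Matrix A₂ A₁ K) (Θ : ι → Matrix A₁ A₁ K) (ε : P ≃ (Fin 2 × J) ⊕ L)
    (δ : J → ι) (ζ : L → A₁ → K) (w' : P → A₂) :
    (∑ w : P → A₁, (∏ p, M (w' p) (w p)) * mf[Θ, δ, ζ, ε] w) =
      mf[(fun i => M * Θ i * Mᵀ), δ, (fun a => M *ᵥ ζ a), ε] w' := by
  classical
  obtain ⟨E, hE1, hE2⟩ := exists_wordEquiv (A₁ := A₁) ε
  -- reindex the product over positions through `ε`
  have hprod : ∀ f : P → K, ∏ p, f p =
      (∏ j, (f (ε.symm (Sum.inl (0, j))) * f (ε.symm (Sum.inl (1, j))))) * ∏ a, f (ε.symm (Sum.inr a)) := by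
    intro f
    rw [← Fintype.prod_equiv ε.symm (fun q => f (ε.symm q)) f (fun _ => rfl), Fintype.prod_sum_type,
      Fintype.prod_prod_type]
    simp only [Fin.prod_univ_two]
    rw [← Finset.prod_mul_distrib]
  -- the right-hand side, expanded
  have hpair : ∀ j, (M * Θ (δ j) * Mᵀ) (w' (ε.symm (Sum.inl (0, j)))) (w' (ε.symm (Sum.inl (1, j)))) =
      ∑ x : A₁ × A₁, M (w' (ε.symm (Sum.inl (0, j)))) x.1 * Θ (δ j) x.1 x.2 * M (w' (ε.symm (Sum.inl (1, j)))) x.2 := by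
    intro j
    rw [Matrix.mul_apply, Fintype.sum_prod_type, Finset.sum_comm]
    refine Finset.sum_congr rfl fun c _ => ?_
    rw [Matrix.mul_apply, Finset.sum_mul, Matrix.transpose_apply]
  have hfree : ∀ a, (M *ᵥ ζ a) (w' (ε.symm (Sum.inr a))) = ∑ x, M (w' (ε.symm (Sum.inr a))) x * ζ a x := fun a => rfl
  simp only [hpair, hfree]
  rw [Fintype.prod_sum, Fintype.prod_sum, Finset.sum_mul_sum, ← Finset.sum_product', Fintype.sum_equiv E
    (fun w => (∏ p, M (w' p) (w p)) * mf[Θ, δ, ζ, ε] w)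
    (fun vs : (J → A₁ × A₁) × (L → A₁) => (∏ j, M (w' (ε.symm (Sum.inl (0, j)))) (vs.1 j).1 * Θ (δ j) (vs.1 j).1 (vs.1 j).2 *
        M (w' (ε.symm (Sum.inl (1, j)))) (vs.1 j).2) * ∏ a, M (w' (ε.symm (Sum.inr a))) (vs.2 a) * ζ a (vs.2 a))]
  · rw [Finset.univ_product_univ]
  · intro w
    rw [hprod (fun p => M (w' p) (w p))]
    simp only [hE1, hE2]
    rw [mul_mul_mul_comm, ← Finset.prod_mul_distrib, ← Finset.prod_mul_distrib]
    refine congrArg₂ (· * ·) (Finset.prod_congr rfl fun j _ => by ring) rfl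

end Covariance

/-! ### §2 Descent of function spans from `ℂ` to `ℚ` -/

section Descent

variable {W : Type*}

/-- **Descent `ℂ → ℚ` for spans of coefficient functions**: if the complexification `algebraMap ℚ ℂ ∘ s` of
`s : W → ℚ` lies in the `ℂ`-span of the complexifications of a set `F` of rational functions, then `s` lies in the
`ℚ`-span of `F` (apply a `ℚ`-linear retraction `ℂ → ℚ` of `1` pointwise). [folklore] -/
theorem mem_span_of_algebraMap_mem_span (F : Set (W → ℚ)) (s : W → ℚ)
    (hs : (fun w => algebraMap ℚ ℂ (s w)) ∈
      Submodule.span ℂ ((fun f : W → ℚ => fun w => algebraMap ℚ ℂ (f w)) '' F)) :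
    s ∈ Submodule.span ℚ F := by
  obtain ⟨l, hl⟩ := exists_ratLinear_retraction
  -- the pointwise retraction `Λ g = l ∘ g`, `ℚ`-linear
  let Λ : (W → ℂ) →ₗ[ℚ] (W → ℚ) :=
    { toFun := fun g w => l (g w)
      map_add' := fun g g' => funext fun w => by simp
      map_smul' := fun q g => funext fun w => by simp }
  have hΛ : ∀ g w, Λ g w = l (g w) := fun g w => rfl
  have hΛι : ∀ (c : ℂ) (f : W → ℚ), Λ (c • fun w => algebraMap ℚ ℂ (f w)) = l c • f := by
    intro c f
    funext w
    rw [hΛ, Pi.smul_apply, Pi.smul_apply, smul_eq_mul, smul_eq_mul, Algebra.algebraMap_eq_smul_one, mul_smul_comm, mul_one,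
      map_smul, smul_eq_mul, mul_comm]
  have key : ∀ g ∈ Submodule.span ℂ ((fun f : W → ℚ => fun w => algebraMap ℚ ℂ (f w)) '' F),
      ∀ c : ℂ, Λ (c • g) ∈ Submodule.span ℚ F := by
    intro g hg
    refine Submodule.span_induction ?_ ?_ ?_ ?_ hg
    · rintro _ ⟨f, hf, rfl⟩ c
      rw [hΛι]
      exact Submodule.smul_mem _ _ (Submodule.subset_span hf)
    · intro c
      rw [smul_zero, map_zero]
      exact Submodule.zero_mem _
    · intro g g' _ _ hg hg' c
      rw [smul_add, map_add]
      exact Submodule.add_mem _ (hg c) (hg' c)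
    · intro d g _ hg c
      rw [smul_smul]
      exact hg (c * d)
  have h1 := key _ hs 1
  rw [one_smul] at h1
  have hs' : Λ (fun w => algebraMap ℚ ℂ (s w)) = s := by
    funext w
    rw [hΛ, Algebra.algebraMap_eq_smul_one, map_smul, hl, smul_eq_mul, mul_one]
  rwa [hs'] at h1

end Descent

end Summit.HodgeConjecture.HodgeConjecture.Theorems.Q8SymplecticPowersMatchingFreeSlots

end
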